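import Mathlib
import Summits.PneNP.PneNP.Theses.OneSlice
import Summits.PneNP.PneNP.Theorems.OneSliceSliceTargetSplit
import Summits.PneNP.PneNP.Theorems.OneSliceMonotoneContinuationPadFibre

/-!
# Route OneSlice, crux `MonotoneContinuation` (stmt-PneNP-18471), line `Sketch_ideator1_r1` (ProfileLine)
# — stub `delFibre_sum`

The landing-level law of uniform-size deletion, exactly normalised (bridge `MC → flat-below`, D1), obtained
from its mirror image `padFibre_sum` (uniform-size padding, U1) by complementation. Deleting a `ρ` of the
slice `a` from an edge vector `x` at level `e(x) = i` lands at level `e(x ∧ ¬ρ)`, and the complement of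
`x ∧ ¬ρ` is the join `¬x ∨ ρ` (de Morgan), so `e(x ∧ ¬ρ) = s` says exactly `e(¬x ∨ ρ) = N - s`
(`N := C(n,2)`, `e(¬y) = N - e(y)`): the deletion fibre `{ρ ∈ slice n a : e(x ∧ ¬ρ) = s}` *is* the padding
fibre of the complement `¬x` (at level `N - i`) for the target level `N - s`, and `s ≤ i ≤ N` is
`N - i ≤ N - s ≤ N`. Summing the landing probabilities over all sizes `a`, `padFibre_sum` evaluates the sum to
`(N + 1)/(N - (N - i) + 1) = (N + 1)/(i + 1)`. For the record, the fibre over the slice `(i - s) + t` has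
`C(i, i - s)·C(N - i, t)` elements (`delFibre_card_fibre`, from `padFibre_card_fibre`).
-/

set_option linter.dupNamespace false -- `Summit.PneNP.PneNP.…`: summit = sub-problem (D-0017)

namespace Summit.PneNP.PneNP.Theorems.MonotoneContinuation

open Literature.Computability.Complexity hiding supp mem_supp
open Finset hiding slice
open Filter hiding mem_sdiff
open Classical
open Summit.PneNP.PneNP.Theorems (binomialWeight_tail_le binomialWeight_sum_range binomialWeight_nonneg
  binomialWeight_variance card_slice)
open Summit.PneNP.PneNP.Theorems.ConstantBand.Negative (Edge thr Central slice)
open Summit.PneNP.PneNP.Theorems.SingleThreshold.Negative (pc)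
open Summit.PneNP.PneNP.Theorems.SliceACZero.Negative (supp mem_supp card_supp supp_injective supp_indicator)
open Summit.PneNP.PneNP.Theorems.SliceTargetSplit (Comp nbhd mem_nbhd transport ind l1 nbhdCard card_nbhd
  card_nbhd_of_le card_nbhd_of_ge choose_mul_nbhdCard nbhdCard_pos sum_slice_sum_nbhd sum_slice_sum_nbhd_left
  supp_subset_of_comp_of_le comp_iff_supp comp_comm ofSet supp_ofSet ofSet_supp edgeCount_ofSet ind_nonneg
  ind_le_one abs_ind_sub_ind l1_triangle l1_comm l1_nonneg transport_nonneg transport_sub)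

noncomputable section

variable {n : ℕ}

/-! ### Levels of complements -/

/-- The support of the complement `¬y` is the complement of the support of `y`. [folklore] -/
theorem delFibre_supp_not (y : Edge n → Bool) : supp (fun e => !y e) = (supp y)ᶜ := by
  ext e
  rw [mem_compl, mem_supp, mem_supp, Bool.not_eq_true', Bool.eq_false_iff]

/-- The level of the complement: `e(¬y) = C(n,2) - e(y)`. [folklore] -/
theorem delFibre_edgeCount_not (y : Edge n → Bool) : edgeCount (fun e => !y e) = n.choose 2 - edgeCount y := by
  rw [← card_supp, ← card_supp, delFibre_supp_not, card_compl, card_edgeSet_top_fin]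

/-- De Morgan for levels: the complement of the deletion `x ∧ ¬ρ` is the join `¬x ∨ ρ`, so
`e(¬x ∨ ρ) = C(n,2) - e(x ∧ ¬ρ)`. [folklore] -/
theorem delFibre_edgeCount_not_or (x ρ : Edge n → Bool) :
    edgeCount (fun e => !x e || ρ e) = n.choose 2 - edgeCount (fun e => x e && !ρ e) := by
  have h := delFibre_edgeCount_not (fun e => x e && !ρ e)
  simp only [Bool.not_and, Bool.not_not] at h
  exact h

/-! ### Deletion fibres are padding fibres of the complement -/

/-- For a target level `s ≤ C(n,2)`, the deletion fibre `{ρ ∈ slice n a : e(x ∧ ¬ρ) = s}` is the padding fibre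
`{ρ ∈ slice n a : e(¬x ∨ ρ) = C(n,2) - s}` of the complement `¬x`. [folklore] -/
theorem delFibre_filter_eq (x : Edge n → Bool) {s : ℕ} (hs : s ≤ n.choose 2) (a : ℕ) :
    (slice n a).filter (fun ρ => edgeCount (fun e => x e && !ρ e) = s) =
      (slice n a).filter (fun ρ => edgeCount (fun e => !x e || ρ e) = n.choose 2 - s) := by
  refine filter_congr fun ρ _ => ?_
  have h := delFibre_edgeCount_not_or x ρ
  have h' : edgeCount (fun e => x e && !ρ e) ≤ n.choose 2 := samplerExpansion_edgeCount_le _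
  omega

/-- **Deletion fibre count.** For `e(x) = s + l ≤ C(n,2)`, the vectors `ρ` of the slice `l + t` with
`e(x ∧ ¬ρ) = s` number `C(s + l, l)·C(C(n,2) - (s + l), t)` (an `l`-subset of `supp x` together with a
`t`-subset of its complement). [folklore] -/
theorem delFibre_card_fibre {x : Edge n → Bool} {s l : ℕ} (hx : edgeCount x = s + l) (hN : s + l ≤ n.choose 2)
    (t : ℕ) :
    #((slice n (l + t)).filter fun ρ => edgeCount (fun e => x e && !ρ e) = s) =
      (s + l).choose l * (n.choose 2 - (s + l)).choose t := by
  have hx' : edgeCount (fun e => !x e) = n.choose 2 - (s + l) := by rw [delFibre_edgeCount_not, hx]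
  rw [delFibre_filter_eq x (by omega) (l + t), show n.choose 2 - s = n.choose 2 - (s + l) + l by omega,
    padFibre_card_fibre hx' l t, Nat.sub_sub_self hN]

/-! ### The stub -/

/-- **Landing-level law of uniform-size deletion (D1).** For `x` at level `i` and a target level `s` with
`s ≤ i ≤ C(n,2)`, summing over all sizes `a` the fraction of the slice `a` whose deletion from `x` lands at
level `s` gives exactly `(C(n,2) + 1)/(i + 1)`: by complementation (`e(x ∧ ¬ρ) = s ↔ e(¬x ∨ ρ) = C(n,2) - s`)
this is the padding law `padFibre_sum` for `¬x` at level `C(n,2) - i` and the target level `C(n,2) - s`, whose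
value is `(C(n,2) + 1)/(C(n,2) - (C(n,2) - i) + 1)`. [folklore] -/
theorem delFibre_sum :
  ∀ (n i s : ℕ) (x : Edge n → Bool), edgeCount x = i → s ≤ i → i ≤ n.choose 2 →
    ∑ a ∈ range (n.choose 2 + 1),
      (#((slice n a).filter fun ρ => edgeCount (fun e => x e && !ρ e) = s) : ℝ) / #(slice n a) =
      ((n.choose 2 : ℝ) + 1) / ((i : ℝ) + 1) := by
  intro n i s x hx hsi hiN
  have hx' : edgeCount (fun e => !x e) = n.choose 2 - i := by rw [delFibre_edgeCount_not, hx]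
  calc ∑ a ∈ range (n.choose 2 + 1),
        (#((slice n a).filter fun ρ => edgeCount (fun e => x e && !ρ e) = s) : ℝ) / #(slice n a)
      = ∑ a ∈ range (n.choose 2 + 1),
          (#((slice n a).filter fun ρ => edgeCount (fun e => !x e || ρ e) = n.choose 2 - s) : ℝ) /
            #(slice n a) := by
        refine sum_congr rfl fun a _ => ?_
        rw [delFibre_filter_eq x (hsi.trans hiN) a]
    _ = ((n.choose 2 : ℝ) + 1) / ((n.choose 2 : ℝ) - ((n.choose 2 - i : ℕ) : ℝ) + 1) :=
        padFibre_sum n (n.choose 2 - i) (n.choose 2 - s) (fun e => !x e) hx' (by omega) (by omega)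
    _ = ((n.choose 2 : ℝ) + 1) / ((i : ℝ) + 1) := by
        rw [Nat.cast_sub hiN]
        ring

end

end Summit.PneNP.PneNP.Theorems.MonotoneContinuation
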